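import Literature.AlgebraicGeometry.Frobenioids.PadicFrobenioidStandardType
import Literature.AlgebraicGeometry.Frobenioids.PerfFactorialPrimes
import HarnessLib

/-!
# Frobenioids II, Theorem 1.2 (i), third sentence — the rationally-standard half: the data-level content
# dischargeable now, and the reduction to the inputs of [FrdI] Def. 4.5 (iii) — PROOF

Mochizuki, *The geometry of Frobenioids II: poly-Frobenioids*, Kyushu J. Math. **62** (2008) 401–460, §1,
Theorem 1.2 (i), kurims text p. 9 l. 9–10: "If `D` is of FSMFF-type, then `C` is of rationally standard type";
proof p. 9: `Φ` is monoprime and "for every `A ∈ Ob(D)`, the homomorphism `B(A) → Φ^gp(A)` is nonzero" (rational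
type), "for `A_D ∈ Ob(D)`, the monoid `End_D(A_D)` acts trivially on `Φ(A_D)`" (Frobenius-compactness), and
[FrdI] Thm. 5.2 (iii). [cite: MochizukiFrdII2008, Thm 1.2 (i) p.9]

PROOF-ONLY (seat abc-iut-L6-t10 gen 2; L1-lead R75 (3) row M17). CENSUS: abc-iut-L1-t4's typed row
`PadicFrd.Thm12_i_standard d V := IsOfFSMFFType D → V.IsOfRationallyStandardType` is a SCHEMA slot over
`V : Thm12Vocab d` (the field `IsOfRationallyStandardType : Prop` is free); it closes only at THE binding
`V.IsOfRationallyStandardType := (ModelFrobenioid.data d.Φ d.B d.divB).IsOfRationallyStandardType R` for THE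
`R : RSParams` (THE birationalization, THE support predicate of Def. 2.4 (i)(d), THE `(C^un-tr)^birat`), which is
not yet constructible in the tree. abc-iut-L1-d10 landed the STANDARD-type half (`thm12_isOfStandardType`) and the
inputs (`endTrivial`, `nonzero`, `isMonoprime`). PROVED here:
* `Datum.exists_divB_eq_of` — **the strict-rationality datum** of the printed proof: since `Φ(A)` is monoprime
  (divisibility is total) and `B(A) → Φ^gp(A)` is nonzero, some `f ∈ B(A)` has a NONZERO EFFECTIVE divisor
  `Div_B(f) = [c]`, `1 ≠ c ∈ Φ(A)` (with `b := 1`, this is `a, b ∈ Φ(A)`, `a − b ∈ Φ^birat`, `𝔭 ∈ Supp a`,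
  `𝔭 ∉ Supp b` for the unique prime `𝔭` of `Φ(A)` — Def. 4.5 (ii));
* `Datum.isOfRationallyStandardType_data_iff` — REDUCTION: for every `R : RSParams` of the `p`-adic model
  Frobenioid over an FSMFF-type base with monoid data, "rationally standard type" (Def. 4.5 (iii)) is
  EQUIVALENT to its three inputs that quote the parametrised constructions — birationally Frobenius-normalized
  type of `R.B`, rational type w.r.t. `(R.B, R.Supp)`, a Frobenius-compact object of `R.BU` — the standard-type
  conjunct being PROVED (`thm12_isOfStandardType`);
* `Thm12_i_standard_of_inputs` — the typed slot `Thm12_i_standard d V` at any `V` whose field is implied by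
  the Def. 4.5 (iii) statement at some `R`, from those three inputs.
No definitions; nothing here bears on [IUTchIII] or asserts anything about abc.
-/

noncomputable section

namespace Literature.AlgebraicGeometry.Frobenioids

open CategoryTheory Opposite Function

namespace PadicFrd

namespace Datum

universe v u

variable {D : Type u} [Category.{v} D] {p : ℕ} [Fact p.Prime] (d : Datum D p)

/-- **Thm. 1.2 (i), proof — the strict-rationality datum** (FrdII p. 9: "`Φ` is monoprime", "the homomorphism
`B(A) → Φ^gp(A)` is nonzero"): for every `A`, some rational function `f ∈ B(A)` has a nonzero effective
divisor, `Div_B(f) = [c]` with `1 ≠ c ∈ Φ(A)`. PROOF: write the nonzero `Div_B(b) = [m]/[s]`; divisibility in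
the monoprime `Φ(A)` is total, so `Div_B(b)` or `Div_B(b⁻¹)` is effective (`B(A)` is a group).
[cite: MochizukiFrdII2008, Thm 1.2 (i) p.9] -/
theorem exists_divB_eq_of (A : Dᵒᵖ) :
    ∃ (f : d.B.obj A) (c : d.Φ.obj A), c ≠ 1 ∧
      Frobenioids.divB d.Φ d.B d.divB A f = Algebra.GrothendieckGroup.of c := by
  obtain ⟨b, hb⟩ := d.nonzero A
  set x : Algebra.GrothendieckGroup (d.Φ.obj A) := Frobenioids.divB d.Φ d.B d.divB A b with hx
  replace hb : x ≠ 1 := hb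
  obtain ⟨⟨m, s⟩, h⟩ := (Localization.monoidOf (⊤ : Submonoid (d.Φ.obj A))).surj x
  change x * Algebra.GrothendieckGroup.of (s : d.Φ.obj A) = Algebra.GrothendieckGroup.of m at h
  rcases (d.isMonoprime A).dvd_total m (s : d.Φ.obj A) with ⟨c, hc⟩ | ⟨c, hc⟩
  · -- `s = m · c`: `Div_B(b) = [c]⁻¹`, so `Div_B(b⁻¹) = [c]`
    have hxc : x = (Algebra.GrothendieckGroup.of c)⁻¹ := by
      rw [hc, map_mul] at h
      rw [eq_inv_iff_mul_eq_one]
      have h' : (x * Algebra.GrothendieckGroup.of c) * Algebra.GrothendieckGroup.of m =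
          1 * Algebra.GrothendieckGroup.of m := by rw [one_mul, mul_assoc, mul_comm (Algebra.GrothendieckGroup.of c), h]
      exact mul_right_cancel h'
    obtain ⟨u, hu⟩ := d.isUnit_B A b
    refine ⟨((u⁻¹ : (d.B.obj A)ˣ) : d.B.obj A), c, fun h1 => hb ?_, ?_⟩
    · rw [hxc, h1, map_one, inv_one]
    · have hinv : Frobenioids.divB d.Φ d.B d.divB A ((u⁻¹ : (d.B.obj A)ˣ) : d.B.obj A) * x = 1 := by
        rw [hx, ← hu, ← map_mul, Units.inv_mul, map_one]
      rw [hxc, mul_inv_eq_one] at hinv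
      exact hinv
  · -- `m = s · c`: `Div_B(b) = [c]`
    have hxc : x = Algebra.GrothendieckGroup.of c := by
      rw [hc, map_mul, mul_comm x] at h
      exact mul_left_cancel h
    refine ⟨b, c, fun h1 => hb ?_, hxc⟩
    rw [hxc, h1, map_one]

/-- **Thm. 1.2 (i), third sentence — REDUCTION to the inputs of [FrdI] Def. 4.5 (iii)** (FrdII p. 9): over a
base `D` of FSMFF-type with `Φ`, `B` monoids on `D`, and for ANY parameters `R : RSParams` of the `p`-adic model
Frobenioid, "`C` is of rationally standard type w.r.t. `R`" holds iff (a) `R.B` is of birationally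
Frobenius-normalized type, every object is rational w.r.t. `(R.B, R.Supp)`, and (b) `(C^un-tr)^birat = R.BU` has
a Frobenius-compact object — the standard-type conjunct of (a) being PROVED (abc-iut-L1-d10's
`thm12_isOfStandardType`). [cite: MochizukiFrdII2008, Thm 1.2 (i) p.9] -/
theorem isOfRationallyStandardType_data_iff (h : d.IsMonoidData) (hD : IsOfFSMFFType D)
    (R : (ModelFrobenioid.data d.Φ d.B d.divB).RSParams) :
    (ModelFrobenioid.data d.Φ d.B d.divB).IsOfRationallyStandardType R ↔
      (PreFrobenioidData.IsOfBiratFrobeniusNormalizedType R.B ∧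
        (∀ A : d.frobenioid, PreFrobenioidData.IsRational R.B R.Supp A) ∧
          ∃ Y : R.BU.Birat, R.BU.ops.IsFrobeniusCompact Y) :=
  ⟨fun hr => ⟨hr.biratFrobNormalized, hr.rational, hr.frobCompact⟩,
    fun hr => ⟨hr.1, hr.2.1, d.thm12_isOfStandardType h hD, hr.2.2⟩⟩

/-- **Thm. 1.2 (i), third sentence, at the typed slot**: abc-iut-L1-t4's `Thm12_i_standard d V` HOLDS for every
vocabulary binding `V` whose "rationally standard" field is implied by the Def. 4.5 (iii) statement at some
parameters `R` (THE binding is of this shape), GIVEN the three residual inputs (a)/(b) above for `R` — i.e. the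
row is reduced to: THE birationalization is birationally Frobenius-normalized (abc-iut-L1-d10,
`thm12_isOfBiratFrobeniusNormalizedType` at `PreFrobenioid.biratData`), every object is rational (from
`exists_divB_eq_of` once `R.Supp` is THE support), and `(C^un-tr)^birat` has a Frobenius-compact object (from
`endTrivial` once THE `(C^un-tr)^birat` exists). [cite: MochizukiFrdII2008, Thm 1.2 (i) p.9] -/
theorem Thm12_i_standard_of_inputs (h : d.IsMonoidData) (V : Thm12Vocab d)
    (R : (ModelFrobenioid.data d.Φ d.B d.divB).RSParams)
    (hV : (ModelFrobenioid.data d.Φ d.B d.divB).IsOfRationallyStandardType R → V.IsOfRationallyStandardType)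
    (hB : PreFrobenioidData.IsOfBiratFrobeniusNormalizedType R.B)
    (hR : ∀ A : d.frobenioid, PreFrobenioidData.IsRational R.B R.Supp A)
    (hC : ∃ Y : R.BU.Birat, R.BU.ops.IsFrobeniusCompact Y) : Thm12_i_standard d V :=
  fun hD => hV ((d.isOfRationallyStandardType_data_iff h hD R).mpr ⟨hB, hR, hC⟩)

end Datum

end PadicFrd

end Literature.AlgebraicGeometry.Frobenioids

end
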